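import Summits.CriticalPhenomena.SAWScalingLimit.Theorems.BoundaryTP2.Negative.TP2CertArith
import HarnessLib

/-!
# Crux `BoundaryTP2` (stmt-CriticalPhenomena-7115): a sharper cell test — exact shifted-Taylor enclosure

Certified-compute seat (refuter `ccert`), part 7.  The one-cell test of part 1 (`cellOK`: crossing product at
the right end ≤ non-crossing product at the left end) loses the full variation of both products over a cell, so
it needs `≈ 1/margin` cells and stops being practical below relative margins `≈ 10⁻³` (slit mouths: `10⁻⁴ … 10⁻⁶`).
Here the difference `E = A·B − C·D` itself (an integer polynomial, `detZ`) is re-expanded exactly about the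
cell's centre in exact integer arithmetic (`shiftH`: `(2·den)^n · E((a+s)/(2·den)) = G(s)`, `a = 2·numL + 5`,
`s ∈ [-5, 5]` on the cell) and bounded below by `g₀ − Σ_{k≥1} |g_k| 5^k` (`absH`, `evZ_ge_of_abs_le`): the test
`cellT` passes iff that integer is non-negative (`cellT_sound`).  `certRecT` is the adaptive subdivision with
this test (or the old one), `certRecT_sound`.  Pure arithmetic, everything proved. [folklore]
-/

namespace Summit.CriticalPhenomena.SAWScalingLimit.Theorems.BoundaryTP2.Negative.Cert

/-! ## §1 Integer coefficient lists -/

/-- Horner evaluation of an integer coefficient list. [folklore] -/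
noncomputable def evZ : List ℤ → ℝ → ℝ
  | [], _ => 0
  | c :: cs, x => c + x * evZ cs x

/-- Evaluation of the empty list. [folklore] -/
@[simp] theorem evZ_nil (x : ℝ) : evZ [] x = 0 := rfl

/-- Horner step. [folklore] -/
@[simp] theorem evZ_cons (c : ℤ) (cs : List ℤ) (x : ℝ) : evZ (c :: cs) x = c + x * evZ cs x := rfl

/-- Natural coefficient lists as integer ones. [folklore] -/
def ofNatList (l : List ℕ) : List ℤ := l.map fun n => (n : ℤ)

/-- Same evaluation. [folklore] -/
theorem evZ_ofNatList (l : List ℕ) (x : ℝ) : evZ (ofNatList l) x = evPoly l x := by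
  induction l with
  | nil => rfl
  | cons n ns ih => simp [ofNatList, evPoly_cons, ← ih]

/-- Coefficientwise sum (with padding). [folklore] -/
def addZ : List ℤ → List ℤ → List ℤ
  | [], q => q
  | p, [] => p
  | a :: p, b :: q => (a + b) :: addZ p q

/-- `addZ` adds. [folklore] -/
theorem evZ_addZ : ∀ (p q : List ℤ) (x : ℝ), evZ (addZ p q) x = evZ p x + evZ q x
  | [], q, x => by simp [addZ]
  | a :: p, [], x => by simp [addZ]
  | a :: p, b :: q, x => by rw [addZ, evZ_cons, evZ_addZ p q x, evZ_cons, evZ_cons]; push_cast; ring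

/-- Scalar multiple. [folklore] -/
def smulZ (a : ℤ) (p : List ℤ) : List ℤ := p.map fun c => a * c

/-- `smulZ` scales. [folklore] -/
theorem evZ_smulZ (a : ℤ) : ∀ (p : List ℤ) (x : ℝ), evZ (smulZ a p) x = a * evZ p x
  | [], x => by simp [smulZ]
  | c :: p, x => by
    have := evZ_smulZ a p x
    simp only [smulZ, List.map_cons, evZ_cons] at this ⊢
    rw [this]; push_cast; ring

/-- Multiplication by `(a + s)`. [folklore] -/
def mulLinZ (a : ℤ) (p : List ℤ) : List ℤ := addZ (smulZ a p) (0 :: p)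

/-- `mulLinZ` multiplies by `(a + s)`. [folklore] -/
theorem evZ_mulLinZ (a : ℤ) (p : List ℤ) (s : ℝ) : evZ (mulLinZ a p) s = (a + s) * evZ p s := by
  rw [mulLinZ, evZ_addZ, evZ_smulZ, evZ_cons]; push_cast; ring

/-- Product. [folklore] -/
def mulZ : List ℤ → List ℤ → List ℤ
  | [], _ => []
  | c :: cs, q => addZ (smulZ c q) (0 :: mulZ cs q)

/-- `mulZ` multiplies. [folklore] -/
theorem evZ_mulZ : ∀ (p q : List ℤ) (x : ℝ), evZ (mulZ p q) x = evZ p x * evZ q x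
  | [], q, x => by simp [mulZ]
  | c :: cs, q, x => by rw [mulZ, evZ_addZ, evZ_smulZ, evZ_cons, evZ_mulZ cs q x, evZ_cons]; push_cast; ring

/-- The TP₂ defect `E = A·B − C·D` as an integer polynomial. [folklore] -/
def detZ (A B C D : List ℕ) : List ℤ :=
  addZ (mulZ (ofNatList A) (ofNatList B)) (smulZ (-1) (mulZ (ofNatList C) (ofNatList D)))

/-- `detZ` evaluates to the defect. [folklore] -/
theorem evZ_detZ (A B C D : List ℕ) (x : ℝ) :
    evZ (detZ A B C D) x = evPoly A x * evPoly B x - evPoly C x * evPoly D x := by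
  rw [detZ, evZ_addZ, evZ_mulZ, evZ_smulZ, evZ_mulZ, evZ_ofNatList, evZ_ofNatList, evZ_ofNatList, evZ_ofNatList]
  push_cast; ring

/-! ## §2 Exact shift: `D^n · E((a+s)/D)` as an integer polynomial in `s` -/

/-- Homogenised Taylor shift: `shiftH a D [E₀,…,E_n] = Σ_j E_j D^{n-j} (a+s)^j` as a polynomial in `s`. [folklore] -/
def shiftH (a D : ℤ) : List ℤ → List ℤ
  | [] => []
  | e :: es => addZ [e * D ^ es.length] (mulLinZ a (shiftH a D es))

/-- **The shift identity**: `evZ (shiftH a D E) s = D^(|E|-1) · E((a+s)/D)`. [folklore] -/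
theorem evZ_shiftH (a D : ℤ) (hD : (D : ℝ) ≠ 0) :
    ∀ (E : List ℤ) (s : ℝ), evZ (shiftH a D E) s = (D : ℝ) ^ (E.length - 1) * evZ E (((a : ℝ) + s) / D)
  | [], s => by simp [shiftH]
  | e :: es, s => by
    rw [shiftH, evZ_addZ, evZ_mulLinZ, evZ_shiftH a D hD es s, evZ_cons, evZ_nil, evZ_cons]
    cases es with
    | nil => simp
    | cons e' es' =>
      simp only [List.length_cons, Nat.add_sub_cancel, mul_zero, add_zero]
      push_cast
      rw [pow_succ]
      field_simp

/-! ## §3 The enclosure on `|s| ≤ ρ` -/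

/-- `Σ_k |g_k| ρ^{k+1}` in Horner form: a bound for `|s · G(s)|` on `|s| ≤ ρ`. [folklore] -/
def absH : List ℤ → ℤ → ℤ
  | [], _ => 0
  | g :: gs, ρ => ρ * (|g| + absH gs ρ)

/-- `absH` is non-negative for `ρ ≥ 0`. [folklore] -/
theorem absH_nonneg : ∀ (gs : List ℤ) {ρ : ℤ}, 0 ≤ ρ → 0 ≤ absH gs ρ
  | [], _, _ => le_rfl
  | g :: gs, _, hρ => mul_nonneg hρ (add_nonneg (abs_nonneg g) (absH_nonneg gs hρ))

/-- The tail bound. [folklore] -/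
theorem abs_mul_evZ_le : ∀ (gs : List ℤ) {ρ : ℤ} {s : ℝ}, 0 ≤ ρ → |s| ≤ ρ → |s * evZ gs s| ≤ (absH gs ρ : ℝ)
  | [], _, _, _, _ => by simp [absH]
  | g :: gs, ρ, s, hρ, hs => by
    have ih := abs_mul_evZ_le gs hρ hs
    have hρ' : (0 : ℝ) ≤ ρ := by exact_mod_cast hρ
    rw [absH, evZ_cons, abs_mul]
    push_cast
    calc |s| * |(g : ℝ) + s * evZ gs s| ≤ ρ * (|(g : ℝ)| + |s * evZ gs s|) :=
          mul_le_mul hs (abs_add_le _ _) (abs_nonneg _) hρ'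
      _ ≤ ρ * (|(g : ℝ)| + absH gs ρ) := by gcongr

/-- **Lower enclosure**: `G(s) ≥ g₀ − absH gs ρ` on `|s| ≤ ρ`. [folklore] -/
theorem evZ_ge_of_abs_le (g : ℤ) (gs : List ℤ) {ρ : ℤ} {s : ℝ} (hρ : 0 ≤ ρ) (hs : |s| ≤ ρ) :
    ((g - absH gs ρ : ℤ) : ℝ) ≤ evZ (g :: gs) s := by
  have h := abs_mul_evZ_le gs hρ hs
  rw [abs_le] at h
  rw [evZ_cons]; push_cast; linarith [h.1]

/-! ## §4 The sharper one-cell test and its subdivision -/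

/-- **One cell, Taylor form**: with `Dd = 2·den d`, `a = 2·numL d m + 5` (so that `Dd·x − a ∈ [-5,5]` on the cell),
the shifted defect `G = shiftH a Dd (detZ A B C D)` satisfies `g₀ ≥ Σ_{k≥1} |g_k| 5^k`. [folklore] -/
def cellT (A B C D : List ℕ) (d m : ℕ) : Bool :=
  match shiftH (2 * (numL d m : ℤ) + 5) (2 * (den d : ℤ)) (detZ A B C D) with
  | [] => true
  | g :: gs => decide (absH gs 5 ≤ g)

/-- Soundness of the Taylor cell test. [folklore] -/
theorem cellT_sound {A B C D : List ℕ} {d m : ℕ} (h : cellT A B C D d m = true) {x : ℝ} (h1 : tR d m ≤ x)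
    (h2 : x ≤ tR d (m + 1)) : evPoly C x * evPoly D x ≤ evPoly A x * evPoly B x := by
  set a : ℤ := 2 * (numL d m : ℤ) + 5 with ha
  set Dd : ℤ := 2 * (den d : ℤ) with hDd
  have hDpos : (0 : ℝ) < (Dd : ℝ) := by rw [hDd]; push_cast; linarith [den_pos d]
  have hD : ((Dd : ℤ) : ℝ) ≠ 0 := hDpos.ne'
  -- the local variable `s = Dd·x − a ∈ [-5, 5]`
  set s : ℝ := (Dd : ℝ) * x - a with hsdef
  have hx : x = ((a : ℝ) + s) / Dd := by rw [hsdef]; field_simp; ring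
  have hs : |s| ≤ (5 : ℤ) := by
    have e1 : tR d m = (numL d m : ℝ) / den d := rfl
    have e2 : tR d (m + 1) = (numL d (m + 1) : ℝ) / den d := rfl
    have hn : (numL d (m + 1) : ℝ) = numL d m + 5 := by simp [numL]; ring
    rw [e1] at h1; rw [e2, hn] at h2
    have hdp := den_pos d
    rw [div_le_iff₀ hdp] at h1
    rw [le_div_iff₀ hdp] at h2
    rw [hsdef, ha, hDd]; push_cast
    rw [abs_le]; constructor <;> nlinarith
  -- the shifted defect and its enclosure
  have key : 0 ≤ evZ (shiftH a Dd (detZ A B C D)) s := by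
    revert h; unfold cellT
    rw [← ha, ← hDd]
    cases hG : shiftH a Dd (detZ A B C D) with
    | nil => intro; simp
    | cons g gs =>
      intro h
      have h' : absH gs 5 ≤ g := by simpa using h
      have := evZ_ge_of_abs_le g gs (by norm_num) hs
      have h'' : (0 : ℝ) ≤ ((g - absH gs 5 : ℤ) : ℝ) := by exact_mod_cast sub_nonneg.2 h'
      linarith
  rw [evZ_shiftH a Dd hD, ← hx, evZ_detZ] at key
  have hpow : (0 : ℝ) < (Dd : ℝ) ^ ((detZ A B C D).length - 1) := pow_pos hDpos _
  nlinarith [key, hpow, mul_nonneg hpow.le (le_refl (0:ℝ))]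

/-- Adaptive dyadic subdivision with fuel, either cell test. [folklore] -/
def certRecT (K : ℕ) (A B C D : List ℕ) : ℕ → ℕ → ℕ → Bool
  | 0, d, m => cellOK K A B C D d m || cellT A B C D d m
  | f + 1, d, m => (cellOK K A B C D d m || cellT A B C D d m) ||
      (certRecT K A B C D f (d + 1) (2 * m) && certRecT K A B C D f (d + 1) (2 * m + 1))

/-- **Soundness of the subdivision with the sharper test.** [folklore] -/
theorem certRecT_sound {K : ℕ} {A B C D : List ℕ} (hA : A.length ≤ K + 1) (hB : B.length ≤ K + 1)
    (hC : C.length ≤ K + 1) (hD : D.length ≤ K + 1) :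
    ∀ (f d m : ℕ), certRecT K A B C D f d m = true →
      ∀ {x : ℝ}, tR d m ≤ x → x ≤ tR d (m + 1) → evPoly C x * evPoly D x ≤ evPoly A x * evPoly B x := by
  have hcell : ∀ {d m : ℕ}, (cellOK K A B C D d m || cellT A B C D d m) = true →
      ∀ {x : ℝ}, tR d m ≤ x → x ≤ tR d (m + 1) → evPoly C x * evPoly D x ≤ evPoly A x * evPoly B x := by
    intro d m h x h1 h2
    rw [Bool.or_eq_true] at h
    rcases h with h | h
    · exact cellOK_sound hA hB hC hD h h1 h2
    · exact cellT_sound h h1 h2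
  intro f
  induction f with
  | zero => intro d m h x h1 h2; exact hcell h h1 h2
  | succ f ih =>
    intro d m h x h1 h2
    rw [certRecT, Bool.or_eq_true, Bool.and_eq_true] at h
    rcases h with h | ⟨hl, hr⟩
    · exact hcell h h1 h2
    · rcases le_total x (tR (d + 1) (2 * m + 1)) with hx | hx
      · exact ih (d + 1) (2 * m) hl (by rwa [tR_succ_double]) hx
      · exact ih (d + 1) (2 * m + 1) hr hx (by rwa [tR_succ_double_succ])

end Summit.CriticalPhenomena.SAWScalingLimit.Theorems.BoundaryTP2.Negative.Cert
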